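import Literature.Computability.AlgebraicComplexity.ExplicitPointTableauCertificates
import HarnessLib

/-!
# Tableau certificates at PRODUCTS of linear forms (points of the Chow variety): the coefficient leaf

Glue file (cell `val-lit`, DIP20 lane; honest framing below), companion of
`ExplicitPointTableauCertificates.lean`. The naive leaf of the kernel evaluator `evalC`
(`PlethysmTableauEvaluation.lean`) computes the symmetric-tensor entry of a term `c · ℓ_1 ⋯ ℓ_m` at a
word `w` as the PERMANENT of the `m × m` matrix `(ℓ_s[w_{s'}])` — `m!` products per label, hopeless in
the kernel for `m = 6, 7`. By the tree's polarisation identity (`symEntry_eq_S`, `TableauEvalBridge.lean`)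
that entry is `α(w)! · [x^{α(w)}] ∏_s L_{ℓ_s}`, and the coefficient of a product of linear forms is
computed by peeling one form at a time (`coeff_linForm_mul`, `TableauPolarization.lean`):
`[x^α] (L_ℓ · Q) = ∑_{v : α_v ≠ 0} ℓ[v] · [x^{α - e_v}] Q`. The recursion only branches over the
variables present in `α` — for three variables and `m = 6` at most `90` leaves instead of `720`, and `1`
for a word sitting in one variable.

Contents:
* §1 the counts `cntL`, `ffactL`, the coefficient recursion `prodCoeffL`, the leaf `symEntryProd` and the
  evaluator `evalCProd` (same column recursion as `evalC`), with **`evalCProd_eq_evalC`** (weak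
  structural check, alternator variables `< Nv`, `m` forms per term);
* §2 `splfPoly_prodPoint_mem_chowSet`: a one-term point with coefficient `1` and `n` forms presents
  `∏_s ℓ_s ∈ chowSet K N n` (DIP's `Ch_N^n`);
* §3 **`le_coordRingMultiplicity_chowSet_of_listCertificate`** — the list form a certificate file
  instantiates for `mult_{λ^*} K[Ch_N^n]` (DIP Thm. 2.3 (2)(a) lower bound `7 ≤ mult_{(34,6,2)}(ℂ[Ch_3^6]_7)`,
  Prop. 5.1's positivity certificates).

HONEST FRAMING: certificate-checking plumbing for the toy model `Pow ⊄ Ch` of DIP 2020; nothing here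
bears on permanent versus determinant; VP ≠ VNP is not proved.

## References
* [DorflerIkenmeyerPanova2020] J. Dörfler, C. Ikenmeyer, G. Panova, *On geometric complexity theory:
  multiplicity obstructions are stronger than occurrence obstructions*, SIAM J. Appl. Algebra Geom. 4
  (2020) = arXiv:1901.04576, §5 (eqs. (5.3)–(5.6): evaluation of tableau highest-weight vectors at
  `p = ℓ_1 ⋯ ℓ_n ∈ Ch_m^n`), §6, Thm. 2.3 (2)(a), Prop. 5.1.

## Mathlib and tree
Mathlib: `MvPolynomial.coeff_one`, `Finsupp.prod_fintype`, `Fin.sum_univ_eq_sum_range`,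
`Fin.prod_univ_eq_prod_range`, `List.getElem_set`.
Tree: `symEntry_eq_S`, `Sfun`, `coefM`, `formM`, `contentL`, `contentL_cons`, `sum_map_eq_sum_get`,
`Enum` (`TableauEvalBridge`); `coeff_linForm_mul`, `linForm`, `ffact`, `splfPoly` (`TableauPolarization`);
`mem_pushAll_getD`, `length_pushAll_getD` (`TableauEvalClosedForm`); `Network.checkWeak`,
`le_coordRingMultiplicity_of_certificate'`, `finRevEnum` (`ExplicitPointTableauCertificates`);
`chowSet`, `coordRingMultiplicity` (`DIP20MultiplicityObstructions`).

Provenance: val-lit cell, prover val-lit-p6 g3.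
-/

namespace Literature.Computability.AlgebraicComplexity

namespace TableauEval

open MvPolynomial
open _root_.Literature.NumberTheory.DiophantineGeometry

/-! ## §1 The coefficient leaf -/

section Leaf

variable {R : Type*} [CommRing R]

/-- The counts `(#{s : w_s = i})_{i < Nv}` of the certificate variables in a word. [folklore] -/
def cntL (Nv : ℕ) (idx : List ℕ) : List ℕ := (List.range Nv).map fun i => countNat i idx

/-- `∏_i (cnt_i)!`. [folklore] -/
def ffactL (cnt : List ℕ) : ℕ := (cnt.map Nat.factorial).prod

/-- **The coefficient of `x^{cnt}` in the product of the linear forms `fs`** (coefficient lists on the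
certificate variables), peeling the first form: `[x^α](L_ℓ · Q) = ∑_{i : α_i ≠ 0} ℓ[i] · [x^{α-e_i}] Q`.
[folklore] -/
def prodCoeffL : List (List R) → List ℕ → R
  | [], cnt => if cnt.all (fun n => n == 0) then 1 else 0
  | ℓ :: fs, cnt => ((List.range cnt.length).map fun i =>
      if cnt.getD i 0 = 0 then 0 else ℓ.getD i 0 * prodCoeffL fs (cnt.set i (cnt.getD i 0 - 1))).sum

/-- **The coefficient leaf**: `∑_t c_t · α(w)! · [x^{α(w)}] ∏_s L_{ℓ_{t,s}}`. [folklore] -/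
def symEntryProd (Nv : ℕ) (P : Point R) (idx : List ℕ) : R :=
  (P.terms.map fun t => t.1 * (((ffactL (cntL Nv idx) : ℕ) : R) * prodCoeffL t.2 (cntL Nv idx))).sum

/-- The column-bijection evaluation with the coefficient leaf (same recursion as `evalCols`). [folklore] -/
def evalColsProd (Nv : ℕ) (P : Point R) : List Column → List (List ℕ) → R
  | [], acc => (acc.map (symEntryProd Nv P)).prod
  | c :: cs, acc =>
    ((permsSign c.vars).map fun q => sgn q.1 * evalColsProd Nv P cs (pushAll acc c.labels q.2)).sum

/-- **Fast evaluator at a sum of products of linear forms in `Nv` variables** (`evalCProd_eq_evalC`).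
[folklore] -/
def evalCProd (Nv : ℕ) (P : Point R) (N : Network) : R :=
  evalColsProd Nv P N.cols (List.replicate N.nlabels [])

/-- The identity enumeration of `Fin Nv` (certificate variable `i` ↦ `i`; used only inside proofs of
this file — the leaf identity is a statement about lists). [folklore] -/
private def idEnum (Nv : ℕ) [NeZero Nv] : Enum (Fin Nv) Nv where
  x i := if h : i < Nv then ⟨i, h⟩ else 0
  xinv v := v
  xinv_lt v := v.isLt
  x_xinv v := by simp [v.isLt]
  xinv_x i hi := by simp [hi]

/-- List sum over `range` as a `Finset.range` sum. [folklore] -/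
private theorem listSum_map_range_eq {M : Type*} [AddCommMonoid M] (f : ℕ → M) :
    ∀ n : ℕ, ((List.range n).map f).sum = ∑ i ∈ Finset.range n, f i
  | 0 => by simp
  | n + 1 => by
    rw [List.range_succ, List.map_append, List.sum_append, Finset.sum_range_succ, listSum_map_range_eq f n]
    simp

/-- List product over `range` as a `Finset.range` product. [folklore] -/
private theorem listProd_map_range_eq {M : Type*} [CommMonoid M] (f : ℕ → M) :
    ∀ n : ℕ, ((List.range n).map f).prod = ∏ i ∈ Finset.range n, f i
  | 0 => by simp
  | n + 1 => by
    rw [List.range_succ, List.map_append, List.prod_append, Finset.prod_range_succ, listProd_map_range_eq f n]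
    simp

/-- A `Fin m`-indexed product over the entries of a list of length `m` is the list product. [folklore] -/
private theorem prod_fin_getD {α M : Type*} [CommMonoid M] (fs : List α) (d : α) (g : α → M) {m : ℕ}
    (hm : fs.length = m) : ∏ s : Fin m, g (fs.getD s d) = (fs.map g).prod := by
  subst hm
  rw [← List.prod_ofFn]
  congr 1
  apply List.ext_getElem (by simp)
  intro i h1 h2
  rw [List.getElem_ofFn, List.getElem_map, List.getD_eq_getElem]

/-- **`prodCoeffL` computes the coefficient of a product of linear forms**: for `cnt` of length `Nv`
and the exponent `α` it encodes, `[x^α] ∏_{ℓ ∈ fs} L_ℓ = prodCoeffL fs cnt`. [folklore] -/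
private theorem coeff_prod_linForm {Nv : ℕ} : ∀ (fs : List (List R)) (cnt : List ℕ)
    (_ : cnt.length = Nv) (α : Fin Nv →₀ ℕ) (_ : ∀ v : Fin Nv, α v = cnt.getD v 0),
    coeff α (fs.map fun ℓ => linForm (fun v : Fin Nv => ℓ.getD v 0)).prod = prodCoeffL fs cnt
  | [], cnt, hc, α, hα => by
    classical
    rw [List.map_nil, List.prod_nil, MvPolynomial.coeff_one, prodCoeffL]
    by_cases h0 : α = 0
    · subst h0
      have hall : cnt.all (fun n => n == 0) = true := by
        rw [List.all_eq_true]
        intro x hx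
        obtain ⟨i, hi, rfl⟩ := List.getElem_of_mem hx
        have h := hα ⟨i, hc ▸ hi⟩
        rw [Finsupp.coe_zero, Pi.zero_apply, List.getD_eq_getElem _ _ hi] at h
        simpa using h.symm
      rw [hall]
      simp
    · have hall : cnt.all (fun n => n == 0) = false := by
        rw [Bool.eq_false_iff, Ne, List.all_eq_true]
        intro hall
        apply h0
        ext v
        have hv : (v : ℕ) < cnt.length := hc ▸ v.isLt
        have h := hall _ (List.getElem_mem hv)
        rw [hα v, List.getD_eq_getElem _ _ hv, Finsupp.coe_zero, Pi.zero_apply]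
        simpa using h
      rw [hall, if_neg (Ne.symm h0)]
      simp
  | ℓ :: fs, cnt, hc, α, hα => by
    classical
    rw [List.map_cons, List.prod_cons, coeff_linForm_mul, prodCoeffL, listSum_map_range_eq, hc,
      ← Fin.sum_univ_eq_sum_range]
    refine Finset.sum_congr rfl fun v _ => ?_
    have hv : (v : ℕ) < cnt.length := hc ▸ v.isLt
    by_cases h0 : cnt.getD v 0 = 0
    · have hα0 : v ∉ α.support := by
        rw [Finsupp.mem_support_iff, not_not, hα v, h0]
      rw [if_neg hα0, if_pos h0, mul_zero]
    · have hα0 : v ∈ α.support := by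
        rw [Finsupp.mem_support_iff, hα v]; exact h0
      rw [if_pos hα0, if_neg h0]
      congr 1
      apply coeff_prod_linForm fs _ (by rw [List.length_set, hc]) _
      intro w
      rw [Finsupp.tsub_apply, Finsupp.single_apply, hα w]
      by_cases hvw : v = w
      · subst hvw
        rw [if_pos rfl, List.getD_eq_getElem cnt 0 hv,
          List.getD_eq_getElem (cnt.set _ _) 0 (by simpa using hv), List.getElem_set_self]
      · rw [if_neg hvw, Nat.sub_zero]
        have hw : (w : ℕ) < cnt.length := hc ▸ w.isLt
        rw [List.getD_eq_getElem cnt 0 hw, List.getD_eq_getElem (cnt.set _ _) 0 (by simpa using hw),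
          List.getElem_set_ne (fun h => hvw (Fin.ext h))]

/-- `countNat` of a cons. [folklore] -/
private theorem countNat_cons (u i : ℕ) (l : List ℕ) :
    countNat u (i :: l) = countNat u l + if i = u then 1 else 0 := by
  unfold countNat
  rw [List.filter_cons]
  by_cases h : i = u
  · simp [h]
  · simp [h]

/-- The content of a word of variables `< Nv`, read through the identity enumeration, at `v` is the
count of `v` in the word. [folklore] -/
private theorem contentL_idEnum_apply {Nv : ℕ} [NeZero Nv] : ∀ (idx : List ℕ) (_ : ∀ i ∈ idx, i < Nv)
    (v : Fin Nv), contentL (idEnum Nv) idx v = countNat v idx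
  | [], _, v => by simp [contentL, countNat]
  | i :: idx, h, v => by
    have hi : i < Nv := h i List.mem_cons_self
    rw [contentL_cons, Finsupp.add_apply, contentL_idEnum_apply idx
      (fun j hj => h j (List.mem_cons_of_mem _ hj)) v, countNat_cons, Finsupp.single_apply, add_comm]
    congr 1
    have hx : (idEnum Nv).x i = ⟨i, hi⟩ := by
      show (if h : i < Nv then (⟨i, h⟩ : Fin Nv) else 0) = _
      rw [dif_pos hi]
    rw [hx]
    by_cases hiv : i = (v : ℕ)
    · rw [if_pos (Fin.ext hiv), if_pos hiv]
    · rw [if_neg (fun h => hiv (congrArg Fin.val h)), if_neg hiv]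

/-- `cntL` read at `v < Nv`. [folklore] -/
private theorem getD_cntL {Nv : ℕ} (idx : List ℕ) (v : ℕ) (hv : v < Nv) :
    (cntL Nv idx).getD v 0 = countNat v idx := by
  unfold cntL
  rw [List.getD_eq_getElem _ _ (by simpa using hv), List.getElem_map, List.getElem_range]

/-- `α(w)!` is `ffactL (cntL Nv w)` for words of variables `< Nv`. [folklore] -/
private theorem ffact_contentL_idEnum {Nv : ℕ} [NeZero Nv] (idx : List ℕ) (h : ∀ i ∈ idx, i < Nv) :
    ffact (contentL (idEnum Nv) idx) = ffactL (cntL Nv idx) := by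
  classical
  unfold ffact ffactL cntL
  rw [Finsupp.prod_fintype _ _ (fun _ => Nat.factorial_zero), List.map_map, listProd_map_range_eq,
    ← Fin.prod_univ_eq_prod_range]
  refine Finset.prod_congr rfl fun v _ => ?_
  rw [contentL_idEnum_apply idx h v]
  rfl

/-- **The coefficient leaf is the naive leaf**: for a point all of whose terms have `m` forms and a word
of `m` variables `< Nv`, `symEntry P w = symEntryProd Nv P w` (`symEntry_eq_S` + `coeff_prod_linForm`).
[cite: DorflerIkenmeyerPanova2020, §5 eq. (5.6) (arXiv p. 13)] -/
theorem symEntry_eq_symEntryProd {Nv : ℕ} [NeZero Nv] (P : Point R) {m : ℕ}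
    (hP : ∀ t : Fin P.terms.length, (P.terms.get t).2.length = m) (idx : List ℕ)
    (hlen : idx.length = m) (hidx : ∀ i ∈ idx, i < Nv) :
    symEntry P idx = symEntryProd Nv P idx := by
  classical
  rw [symEntry_eq_S (idEnum Nv) P hP idx hlen hidx]
  unfold Sfun symEntryProd splfPoly
  rw [coeff_sum, Finset.mul_sum, sum_map_eq_sum_get]
  refine Finset.sum_congr rfl fun t _ => ?_
  rw [coeff_C_mul]
  have hprod : (∏ s : Fin m, linForm (formM (idEnum Nv) P m t s)) =
      (((P.terms.get t).2).map fun ℓ => linForm fun v : Fin Nv => ℓ.getD v 0).prod := by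
    rw [← prod_fin_getD ((P.terms.get t).2) [] (fun ℓ => linForm fun v : Fin Nv => ℓ.getD v 0) (hP t)]
    rfl
  have hα : ∀ v : Fin Nv, contentL (idEnum Nv) idx v = (cntL Nv idx).getD v 0 := fun v => by
    rw [contentL_idEnum_apply idx hidx v, getD_cntL idx v v.isLt]
  rw [hprod, coeff_prod_linForm _ (cntL Nv idx) (by simp [cntL]) _ hα, ffact_contentL_idEnum idx hidx]
  unfold coefM
  ring

/-- Every insertion of `a` into `l` consists of `a` and the elements of `l`. [folklore] -/
private theorem mem_of_mem_insertions {α : Type*} (a : α) : ∀ (l : List α) (r : Bool × List α),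
    r ∈ insertions a l → ∀ j ∈ r.2, j = a ∨ j ∈ l
  | [], r, h, j, hj => by
    simp [insertions] at h
    subst h
    simp at hj
    exact Or.inl hj
  | b :: l, r, h, j, hj => by
    simp only [insertions, List.mem_cons, List.mem_map] at h
    rcases h with rfl | ⟨r', hr', rfl⟩
    · simp only [List.mem_cons] at hj
      rcases hj with rfl | rfl | hj
      · exact Or.inl rfl
      · exact Or.inr List.mem_cons_self
      · exact Or.inr (List.mem_cons_of_mem _ hj)
    · simp only [List.mem_cons] at hj
      rcases hj with rfl | hj
      · exact Or.inr List.mem_cons_self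
      · rcases mem_of_mem_insertions a l r' hr' j hj with h1 | h1
        · exact Or.inl h1
        · exact Or.inr (List.mem_cons_of_mem _ h1)

/-- Every signed permutation of `l` consists of elements of `l`. [folklore] -/
private theorem mem_of_mem_permsSign {α : Type*} : ∀ (l : List α) (q : Bool × List α),
    q ∈ permsSign l → ∀ j ∈ q.2, j ∈ l
  | [], q, h, j, hj => by simp [permsSign] at h; subst h; simp at hj
  | a :: l, q, h, j, hj => by
    rw [permsSign, List.mem_flatMap] at h
    obtain ⟨q', hq', h⟩ := h
    rw [List.mem_map] at h
    obtain ⟨r, hr, rfl⟩ := h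
    rcases mem_of_mem_insertions a q'.2 r hr j hj with h1 | h1
    · exact h1 ▸ List.mem_cons_self
    · exact List.mem_cons_of_mem _ (mem_of_mem_permsSign l q' hq' j h1)

/-- Every signed permutation of `l` has the length of `l`. [folklore] -/
private theorem length_of_mem_permsSign'' {α : Type*} : ∀ (l : List α) (q : Bool × List α),
    q ∈ permsSign l → q.2.length = l.length
  | [], q, h => by simp [permsSign] at h; simp [h]
  | a :: l, q, h => by
    rw [permsSign, List.mem_flatMap] at h
    obtain ⟨q', hq', h⟩ := h
    rw [List.mem_map] at h
    obtain ⟨r, hr, rfl⟩ := h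
    have hlen : ∀ (l' : List α) (r : Bool × List α), r ∈ insertions a l' → r.2.length = l'.length + 1 := by
      intro l'
      induction l' with
      | nil => intro r hr; simp [insertions] at hr; simp [hr]
      | cons b l' ih =>
        intro r hr
        simp only [insertions, List.mem_cons, List.mem_map] at hr
        rcases hr with rfl | ⟨r', hr', rfl⟩
        · simp
        · simp [ih r' hr']
    simp only [List.length_cons]
    rw [hlen q'.2 r hr, length_of_mem_permsSign'' l q' hq']

/-- `evalColsProd = evalCols` for accumulators whose final words have length `m` and letters `< Nv`.
[folklore] -/
private theorem evalColsProd_eq {Nv : ℕ} [NeZero Nv] (P : Point R) {m : ℕ}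
    (hP : ∀ t : Fin P.terms.length, (P.terms.get t).2.length = m) :
    ∀ (cs : List Column) (acc : List (List ℕ)),
    (∀ c ∈ cs, c.vars.length = c.labels.length) → (∀ c ∈ cs, ∀ i ∈ c.vars, i < Nv) →
    (∀ c ∈ cs, ∀ u ∈ c.labels, u < acc.length) →
    (∀ u, u < acc.length → (acc.getD u []).length + countNat u (cs.flatMap Column.labels) = m) →
    (∀ u, ∀ j ∈ acc.getD u [], j < Nv) →
    evalColsProd Nv P cs acc = evalCols P cs acc
  | [], acc, _, _, _, hlen, hlet => by
    rw [evalColsProd, evalCols]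
    congr 1
    apply List.map_congr_left
    intro w hw
    obtain ⟨u, hu, rfl⟩ := List.getElem_of_mem hw
    have h := hlen u hu
    simp only [List.flatMap_nil, countNat, List.filter_nil, List.length_nil, add_zero] at h
    rw [List.getD_eq_getElem acc [] hu] at h
    have hlet' : ∀ j ∈ acc[u], j < Nv := by
      intro j hj
      exact hlet u j (by rwa [List.getD_eq_getElem acc [] hu])
    exact (symEntry_eq_symEntryProd P hP _ h hlet').symm
  | c :: cs, acc, hvl, hvar, hlab, hlen, hlet => by
    rw [evalColsProd, evalCols]
    congr 1
    refine List.map_congr_left fun q hq => ?_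
    have hq2 : q.2.length = c.labels.length := by
      rw [← hvl c (List.mem_cons_self ..)]
      exact length_of_mem_permsSign'' c.vars q hq
    congr 1
    apply evalColsProd_eq P hP
    · exact fun c' hc' => hvl c' (List.mem_cons_of_mem _ hc')
    · exact fun c' hc' => hvar c' (List.mem_cons_of_mem _ hc')
    · intro c' hc' u hu
      rw [length_pushAll]
      exact hlab c' (List.mem_cons_of_mem _ hc') u hu
    · intro u hu
      rw [length_pushAll] at hu
      rw [length_pushAll_getD acc c.labels q.2 hq2.symm
        (fun u' hu' => hlab c (List.mem_cons_self ..) u' hu') u]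
      have h := hlen u hu
      simp only [List.flatMap_cons, countNat, List.filter_append, List.length_append] at h ⊢
      omega
    · intro u j hj
      rcases mem_pushAll_getD acc c.labels q.2 u j hj with h1 | h1
      · exact hlet u j h1
      · exact hvar c (List.mem_cons_self ..) j (mem_of_mem_permsSign c.vars q hq j h1)

/-- **The coefficient-leaf evaluator is the naive one** for networks passing the weak structural check
whose alternator variables are `< Nv`, at points all of whose terms have `perLabel` forms: both compute
DIP's contraction (5.6). [cite: DorflerIkenmeyerPanova2020, §5 eq. (5.6) (arXiv p. 13)] -/
theorem evalCProd_eq_evalC {Nv : ℕ} [NeZero Nv] (P : Point R) (N : Network) (hN : N.checkWeak = true)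
    (hvar : ∀ c ∈ N.cols, ∀ i ∈ c.vars, i < Nv)
    (hP : ∀ t : Fin P.terms.length, (P.terms.get t).2.length = N.perLabel) :
    evalCProd Nv P N = evalC P N := by
  have h := hN
  simp only [Network.checkWeak, Bool.and_eq_true, List.all_eq_true, beq_iff_eq, decide_eq_true_eq,
    List.mem_range] at h
  obtain ⟨⟨hvl, hlab⟩, hcnt⟩ := h
  unfold evalCProd evalC
  apply evalColsProd_eq P hP
  · exact hvl
  · exact hvar
  · intro c hc u hu
    rw [List.length_replicate]
    exact hlab u (List.mem_flatMap.mpr ⟨c, hc, hu⟩)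
  · intro u hu
    rw [List.length_replicate] at hu
    rw [List.getD_eq_getElem _ _ (by simpa using hu), List.getElem_replicate, List.length_nil,
      zero_add]
    exact hcnt u hu
  · intro u j hj
    rw [List.getD_eq_getElem?_getD, List.getElem?_replicate] at hj
    split_ifs at hj with h
    · simp at hj
    · simp at hj

end Leaf

/-! ## §2 One-term points with coefficient `1` present products of linear forms: members of `Ch_N^n` -/

section ChowMembership

variable {N : ℕ} [NeZero N]

/-- The form presented by a one-term point `(c, [ℓ_1,…,ℓ_n])` is `c · ∏_s L_{ℓ_s}`. [folklore] -/
private theorem splfPoly_oneTerm (K : Type) [Field K] (n : ℕ) (P : Point K) (c : K) (fs : List (List K))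
    (hP : P.terms = [(c, fs)]) :
    splfPoly (coefM P) (formM (finRevEnum N) P n) =
      C c * ∏ s : Fin n, linForm fun v : Fin N => (fs.getD s []).getD ((finRevEnum N).xinv v) 0 := by
  have hlen : P.terms.length = 1 := by rw [hP]; rfl
  let t0 : Fin P.terms.length := ⟨0, by rw [hlen]; exact Nat.zero_lt_one⟩
  have ht : ∀ t : Fin P.terms.length, t = t0 := fun t => Fin.ext (by
    have h1 : (t : ℕ) < 1 := lt_of_lt_of_eq t.isLt hlen
    show (t : ℕ) = 0
    omega)
  have hget : P.terms.get t0 = (c, fs) := by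
    simp only [List.get_eq_getElem, t0, hP]
    rfl
  unfold splfPoly
  rw [Fintype.sum_eq_single t0 (fun t hne => absurd (ht t) hne)]
  simp only [coefM, hget]
  congr 1
  refine Finset.prod_congr rfl fun s _ => ?_
  congr 1
  funext v
  unfold formM
  rw [hget]

/-- **A one-term point with coefficient `1` presents a product of `n` linear forms**, a member of DIP's
`chowSet K N n` (`Ch_N^n = {ℓ_1 ⋯ ℓ_n}`). [cite: DorflerIkenmeyerPanova2020, §2 (arXiv p. 3)] -/
theorem splfPoly_oneTerm_mem_chowSet (K : Type) [Field K] (n : ℕ) (P : Point K) (fs : List (List K))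
    (hP : P.terms = [(1, fs)]) :
    splfPoly (coefM P) (formM (finRevEnum N) P n) ∈ chowSet K N n := by
  refine ⟨fun s v => (fs.getD s []).getD ((finRevEnum N).xinv v) 0, ?_⟩
  rw [splfPoly_oneTerm K n P 1 fs hP, map_one, one_mul]
  rfl

end ChowMembership

/-! ## §3 The list form for Chow points (what a certificate file instantiates) -/

section ListForm

variable {N : ℕ} [NeZero N]

/-- Reduction modulo `p` detects nonsingularity of an integer matrix. [folklore] -/
private theorem det_ne_zero_of_map_zmod' {r : ℕ} (p : ℕ) (M : Matrix (Fin r) (Fin r) ℤ)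
    (h : ((Int.castRingHom (ZMod p)).mapMatrix M).det ≠ 0) : M.det ≠ 0 := by
  intro h0
  apply h
  rw [← RingHom.map_det, h0, map_zero]

/-- A square matrix with a right inverse over a nontrivial commutative ring has nonzero determinant.
[folklore] -/
private theorem det_ne_zero_of_mul_eq_one' {R : Type*} [CommRing R] [Nontrivial R] {r : ℕ}
    {M B : Matrix (Fin r) (Fin r) R} (h : M * B = 1) : M.det ≠ 0 := by
  intro h0
  have h1 := congrArg Matrix.det h
  rw [Matrix.det_mul, h0, zero_mul, Matrix.det_one] at h1
  exact zero_ne_one h1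

/-- **Certificate theorem, list form, Chow points.** A certificate file supplies: the networks `netsL`
(shape `lamL` = sorted parts of `lam`, canonical alternators, `d` labels, `m` boxes per label, columns in any
order), the integer Chow points `ptsL` (each the `m` coefficient lists of `ℓ_1, …, ℓ_m`, presenting
`∏_s ℓ_s ∈ Ch_N^m`), the table `vals` of the coefficient-leaf evaluator's INTEGER values (one kernel lemma
per entry) and a right inverse `B` of the table modulo `p`; conclusion `r ≤ mult_{λ^*} K[Ch_N^m]`
(`coordRingMultiplicity` of `chowSet K N m`). [cite: DorflerIkenmeyerPanova2020, §5–§6 (arXiv pp. 13–15), Thm. 2.3 (2)(a), Prop. 5.1] -/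
theorem le_coordRingMultiplicity_chowSet_of_listCertificate (K : Type) [Field K] [CharZero K]
    {m d e r : ℕ} (hm : m ≠ 0) (lam : Nat.Partition e) (lamL : List ℕ)
    (hlamL : lam.sortedParts = lamL) (hlen : lamL.length ≤ N)
    (netsL : List Network) (ptsL : List (List (List ℤ))) (hr1 : netsL.length = r)
    (hr2 : ptsL.length = r)
    (hnets : ∀ Nw ∈ netsL, Nw.checkWeak = true ∧ Nw.canonicalVars = true ∧ Nw.nlabels = d ∧
      Nw.perLabel = m ∧ Nw.shape = lamL)
    (hptsL : ∀ fs ∈ ptsL, fs.length = m)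
    (vals : List (List ℤ))
    (hvals : ∀ a b : ℕ, a < r → b < r →
      evalCProd N (⟨[(1, ptsL.getD b [])]⟩ : Point ℤ) (netsL.getD a ⟨0, 0, []⟩) =
        (vals.getD a []).getD b 0)
    (p : ℕ) [Fact (1 < p)] (B : Matrix (Fin r) (Fin r) (ZMod p))
    (hB : (Int.castRingHom (ZMod p)).mapMatrix (Matrix.of fun a b : Fin r => (vals.getD a []).getD b 0)
      * B = 1) :
    r ≤ coordRingMultiplicity K (chowSet K N m) m (Weight.dualOfPartition N lam) := by
  classical
  let nets : Fin r → Network := fun a => netsL.getD a ⟨0, 0, []⟩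
  let pts : Fin r → Point ℤ := fun b => ⟨[(1, ptsL.getD b [])]⟩
  have hmemN : ∀ a : Fin r, nets a ∈ netsL := fun a => by
    show netsL.getD a _ ∈ netsL
    rw [List.getD_eq_getElem _ _ (by rw [hr1]; exact a.isLt)]
    exact List.getElem_mem _
  have hmemP : ∀ b : Fin r, ptsL.getD b [] ∈ ptsL := fun b => by
    rw [List.getD_eq_getElem _ _ (by rw [hr2]; exact b.isLt)]
    exact List.getElem_mem _
  have hpts : ∀ b, ∀ t ∈ (pts b).terms, t.2.length = m := by
    intro b t ht
    simp only [pts, List.mem_singleton] at ht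
    subst ht
    exact hptsL _ (hmemP b)
  -- the points lie in `Ch`
  have hZ : ∀ b, splfPoly (coefM ((pts b).map (Int.castRingHom K)))
      (formM (finRevEnum N) ((pts b).map (Int.castRingHom K)) m) ∈ chowSet K N m := by
    intro b
    apply splfPoly_oneTerm_mem_chowSet K m _ ((ptsL.getD b []).map fun l => l.map (Int.castRingHom K))
    show [((Int.castRingHom K) 1, (ptsL.getD b []).map fun l => l.map (Int.castRingHom K))] = _
    rw [map_one]
  -- alternator variables are `< N`
  have hvarsN : ∀ a, ∀ cl ∈ (nets a).cols, ∀ v ∈ cl.vars, v < N := by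
    intro a cl hcl v hv
    obtain ⟨_, hcan, -, -, hshape⟩ := hnets _ (hmemN a)
    have hcan' : cl.vars = List.range cl.labels.length := by
      simp only [Network.canonicalVars, List.all_eq_true, beq_iff_eq] at hcan
      exact hcan cl hcl
    rw [hcan', List.mem_range] at hv
    obtain ⟨col, rfl⟩ := List.mem_iff_get.mp hcl
    exact lt_of_lt_of_le hv (le_trans (Cert.height_le_length _ _ hshape col) hlen)
  -- the integer evaluation matrix is the table
  have hM : (Matrix.of fun a b => evalC (pts b) (nets a)) =
      Matrix.of fun a b : Fin r => (vals.getD a []).getD b 0 := by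
    ext a b
    rw [Matrix.of_apply, Matrix.of_apply, ← hvals a b a.isLt b.isLt]
    obtain ⟨hcheck, -, -, hperm, -⟩ := hnets _ (hmemN a)
    refine (evalCProd_eq_evalC _ _ hcheck (hvarsN a) ?_).symm
    intro t
    rw [hperm]
    exact hpts b _ (List.get_mem _ _)
  have hdet : (Matrix.of fun a b => evalC (pts b) (nets a)).det ≠ 0 := by
    rw [hM]
    exact det_ne_zero_of_map_zmod' p _ (det_ne_zero_of_mul_eq_one' hB)
  exact le_coordRingMultiplicity_of_certificate' K hm lam lamL hlamL hlen nets
    (fun a => (hnets _ (hmemN a)).1) (fun a => (hnets _ (hmemN a)).2.1)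
    (fun a => (hnets _ (hmemN a)).2.2.1) (fun a => (hnets _ (hmemN a)).2.2.2.1)
    (fun a => (hnets _ (hmemN a)).2.2.2.2) pts hpts _ hZ hdet

end ListForm

end TableauEval

end Literature.Computability.AlgebraicComplexity
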